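import Summits.BirchSwinnertonDyer.BirchSwinnertonDyer.Theorems.ManinLocalTwoThreeShiftConjugationInvariance
import Summits.BirchSwinnertonDyer.BirchSwinnertonDyer.Theorems.ManinLocalTwoThreeHeckeCongruenceCharacter
import Summits.BirchSwinnertonDyer.BirchSwinnertonDyer.Theorems.ManinLocalTwoThreeEisensteinEnd
import Literature.NumberTheory.EllipticCurves.Gamma0CocycleDegeneracyHecke
import Summits.BirchSwinnertonDyer.BirchSwinnertonDyer.Theorems.AdditiveKolyvaginRoadManinFrameResidueProperRTameTwistGamma0
import HarnessLib

/-!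
# E-es-38 `OddShiftReduction` PROVED: for odd `n`, `tⁿ`-shift invariance of a generalised Hecke eigen-homomorphism with
# hNT(`t`) implies `t`-shift invariance

Summit `BirchSwinnertonDyer`, route `ManinLocalTwoThree` (cell bsd-f2-manin), deciding crux C2 `ManinOddAtFour`
(stmt-BirchSwinnertonDyer-22967), skeleton `kato_shift_two` v6 (`Cruxes/ManinOddAtFour/Lines/kato_shift_two.lean`), stub 3
`stub_cThreeImageResidual` (the 3 950 `C₃`-image classes).  The es planner's line for that stub (MEMO-es §25,
HOME/es/Sketch-es-g12.lean) proves the PARABOLIC relative Ihara vanishing E-es-36 at `(2,2,3)` and `(2,q,1)` under the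
`t`-power non-Eisenstein hypothesis hNT; its step (N) reduces odd `n` to `n = 1`.  This file proves (N) = **E-es-38
`EsG12.OddShiftReduction p t n`**, with the sketch's statement VERBATIM as `oddShiftReduction` (`NotTrivialEisensteinAt`
unfolded), from parts 1/3–2/3 (`…ShiftRelationDepth.lean`, `…ShiftConjugationInvariance.lean`), LEMMA G (p600663) and
LEMMA C (p604131):

* `shiftDifference_apply_eq_zero_of_deep` — with `n = 2m+1`, `diag(t,1) = diag(t,1)ⁿ·(t·diag(t,t⁻¹))^{−m}`: for
  `δ ∈ Γ₀(Lt) ∩ Γ(t^{e+2m})` the `t^{2m}`-down-shift `δ̃ ∈ Γ₀(L)` has `diag(t,t⁻¹)^m ιδ̃ diag(t,t⁻¹)^{−m} = ιδ` (so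
  `u δ = u δ̃`, GOODness of `diag(t,t⁻¹)^m ∈ Δ_t(L′)`) and its `tⁿ`-shift is the `t`-shift of `δ` (so `u(δ↑) = u δ̃`):
  `π_t^*u − π_1^*u` kills `Γ₀(Lt) ∩ Γ(t^{e+2m})`;
* `oddShiftReduction` — LEMMA C makes `π_t^*u − π_1^*u` an exact `T_r`-eigenvector with eigenvalue `r + 1` for
  `r ≡ 1 (mod t^{e+2m})`; it is generalised `λ(r)`-eigen (`isHeckeGenEigenvector_degeneracyPullbackZ`); hNT gives such an
  `r ∉ S` with `λ(r) ≠ r + 1`; so it vanishes (`eq_of_apply_eq_smul_of_mem_maxGenEigenspace`).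

No parabolicity is used (as §25.3 (N) says).  No new definitions; nothing about BSD or Manin's conjecture is proved here.
References: HOME/MEMO-es.md §25.2 (E-es-38), §25.3 (N), (C); A. Wiles, Ann. of Math. 141 (1995) Lemma 2.5 (the
Eisenstein-nilpotence device); J.-P. Serre, *Trees*, II.1.4.
-/

set_option autoImplicit false
set_option linter.dupNamespace false

open scoped MatrixGroups

open CongruenceSubgroup Matrix.SpecialLinearGroup Literature.NumberTheory.EllipticCurves.ModularForms
  Literature.NumberTheory.EllipticCurves.ModularForms.HidaCohomology
  Summit.BirchSwinnertonDyer.BirchSwinnertonDyer.Theorems.ConjSpanGenAllLevels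

namespace Summit.BirchSwinnertonDyer.BirchSwinnertonDyer.Theorems.ManinLocalTwoThree

/-! ### E-es-38: odd `tⁿ`-shift invariance implies `t`-shift invariance -/

section OddShift

/-- **The difference `π_t^* u − π_1^* u` kills a deep `t`-congruence subgroup of `Γ₀(Lt)`** when `u` is
`t^{2m+1}`-shift-invariant: for `δ ∈ Γ₀(Lt) ∩ Γ(t^{e+2m})` (`e` the depth loss of `diag(t,t⁻¹)^m`), shifting `δ` down by
`t^{2m}` gives `δ̃ ∈ Γ₀(L)` with `diag(t,t⁻¹)^m ι δ̃ diag(t,t⁻¹)^{−m} = ι δ` (so `u δ = u δ̃`, GOODness) and whose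
`t^{2m+1}`-shift is the `t`-shift of `δ` (so `u(δ↑) = u δ̃`). [folklore] -/
theorem shiftDifference_apply_eq_zero_of_deep {t m L : ℕ} [NeZero t] [NeZero L] {K : Type*} [CommRing K]
    (ht : t.Prime) {u : Gamma0 L → Fin 1 → K}
    (hsh : ∀ γ γ' : Gamma0 L, ((γ' : SL(2, ℤ)) 0 0 = (γ : SL(2, ℤ)) 0 0 ∧
      (γ' : SL(2, ℤ)) 0 1 = (t : ℤ) ^ (2 * m + 1) * (γ : SL(2, ℤ)) 0 1 ∧
      (t : ℤ) ^ (2 * m + 1) * (γ' : SL(2, ℤ)) 1 0 = (γ : SL(2, ℤ)) 1 0 ∧ (γ' : SL(2, ℤ)) 1 1 = (γ : SL(2, ℤ)) 1 1) → u γ' = u γ)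
    {e : ℕ}
    (hgood : ∀ M : ℕ, e ≤ M → ∀ γ : Gamma0 L, (γ : SL(2, ℤ)) ∈ Gamma (t ^ M) →
      ∃ γ' : Gamma0 L, ConjSpanGenAllLevels.iota t (γ' : SL(2, ℤ)) =
          diagP t ^ m * ConjSpanGenAllLevels.iota t (γ : SL(2, ℤ)) * (diagP t ^ m)⁻¹ ∧
        (γ' : SL(2, ℤ)) ∈ Gamma (t ^ (M - e)) ∧ u γ' = u γ)
    (δ : Gamma0 (L * t)) (hδ : (δ : SL(2, ℤ)) ∈ Gamma (t ^ (e + 2 * m))) :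
    u (Gamma0.degeneracyConj L (L * t) t dvd_rfl δ) = u (Gamma0.degeneracyConj L (L * t) 1 (by simp) δ) := by
  have ht0 : t ≠ 0 := ht.ne_zero
  have htZ : (t : ℤ) ≠ 0 := by exact_mod_cast ht0
  set δ₁ : Gamma0 L := Gamma0.degeneracyConj L (L * t) 1 (by simp) δ with hδ₁
  set δu : Gamma0 L := Gamma0.degeneracyConj L (L * t) t dvd_rfl δ with hδu
  have hδ₁coe : (δ₁ : SL(2, ℤ)) = (δ : SL(2, ℤ)) := Gamma0.coe_degeneracyConj_one _ _
  have hLt : ((L * t : ℕ) : ℤ) ∣ (δ : SL(2, ℤ)) 1 0 := ManinFrameResidueProperRTameTwist.natCast_dvd_entry10 δ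
  have htLt : (t : ℤ) ∣ ((L * t : ℕ) : ℤ) := ⟨(L : ℤ), by push_cast; ring⟩
  have htδ : (t : ℤ) ∣ (δ : SL(2, ℤ)) 1 0 := htLt.trans hLt
  -- entries of the `t`-shift `δu`
  have hu00 : (δu : SL(2, ℤ)) 0 0 = (δ : SL(2, ℤ)) 0 0 := rfl
  have hu01 : (δu : SL(2, ℤ)) 0 1 = (t : ℤ) * (δ : SL(2, ℤ)) 0 1 := rfl
  have hu10 : (δu : SL(2, ℤ)) 1 0 = (δ : SL(2, ℤ)) 1 0 / (t : ℤ) := rfl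
  have hu11 : (δu : SL(2, ℤ)) 1 1 = (δ : SL(2, ℤ)) 1 1 := rfl
  -- shift `δ` down by `t^{2m}`
  obtain ⟨-, d2, -, -⟩ := (mem_Gamma_iff_dvd _ _).mp hδ
  have hb : (t : ℤ) ^ (2 * m) ∣ (δ₁ : SL(2, ℤ)) 0 1 := by
    rw [hδ₁coe]
    refine (pow_dvd_pow (t : ℤ) (by omega : 2 * m ≤ e + 2 * m)).trans ?_
    exact_mod_cast d2
  obtain ⟨X, hX⟩ := exists_shiftRel_down (δ₁ : SL(2, ℤ)) hb
  have hXmem : X ∈ Gamma0 L := mem_Gamma0_of_dvd_apply_one_zero X (by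
    rw [← hX.2.2.1]; exact (ManinFrameResidueProperRTameTwist.natCast_dvd_entry10 δ₁).mul_left _)
  have hδ₁Γ : (δ₁ : SL(2, ℤ)) ∈ Gamma (t ^ (e + 2 * m)) := by rw [hδ₁coe]; exact hδ
  have hXd : X ∈ Gamma (t ^ (e + 2 * m - 2 * m)) := mem_Gamma_of_shiftRel' t ht0 (by omega) hX hδ₁Γ
  rw [Nat.add_sub_cancel] at hXd
  -- GOODness of `diag(t,t⁻¹)^m`: `u δ₁ = u X`
  obtain ⟨γ', hγ', -, huγ'⟩ := hgood e le_rfl ⟨X, hXmem⟩ hXd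
  have R1 := shiftRel_iota_pow t (2 * m) hX
  have R2 := shiftRel_diagP_pow_conj t (ConjSpanGenAllLevels.iota t X) m
  have heq : diagP t ^ m * ConjSpanGenAllLevels.iota t X * (diagP t ^ m)⁻¹ = ConjSpanGenAllLevels.iota t (δ₁ : SL(2, ℤ)) :=
    shiftRel_unique ((t : Away t) ^ (2 * m)) (isUnit_natCast_pow (p := t) (2 * m)) R2 R1
  have hγ'δ₁ : γ' = δ₁ := by
    apply Subtype.ext
    apply iota_injective ht0
    rw [hγ', heq]
  have h1 : u δ₁ = u ⟨X, hXmem⟩ := by rw [← hγ'δ₁, huγ']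
  -- the `t^{2m+1}`-shift of `X` is `δu`: `u δu = u X`
  have h2 : u δu = u ⟨X, hXmem⟩ := by
    refine hsh ⟨X, hXmem⟩ δu ⟨?_, ?_, ?_, ?_⟩
    · rw [hu00, ← hδ₁coe]; exact hX.1
    · rw [hu01, ← hδ₁coe, hX.2.1]; ring
    · show (t : ℤ) ^ (2 * m + 1) * (δu : SL(2, ℤ)) 1 0 = X 1 0
      rw [hu10, ← hX.2.2.1, hδ₁coe, pow_succ, mul_assoc, Int.mul_ediv_cancel' htδ]
    · rw [hu11, ← hδ₁coe]; exact hX.2.2.2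
  rw [h2, h1]

/-- **E-es-38 `OddShiftReduction p t n` — the es sketch's statement verbatim** (HOME/es/Sketch-es-g12.lean, with
`NotTrivialEisensteinAt t S λ` unfolded): for odd `n`, a `tⁿ`-shift-invariant generalised Hecke eigen-homomorphism
`u : Γ₀(L) → K` whose system is not trivial-Eisenstein along `t`-power congruences (hNT) is `t`-shift-invariant.
Proof (MEMO-es §25.3 (N)): `c := π_t^*u − π_1^*u ∈ Z¹(Γ₀(Lt), K)` kills `Γ₀(Lt) ∩ Γ(t^{M})` for `M ≫ 0`
(`shiftDifference_apply_eq_zero_of_deep` with `exists_good_of_mem_Delta` at `diag(t,t⁻¹)^m`, `n = 2m+1`), so LEMMA C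
(`heckeU_eq_smul_of_kills_congruence`) gives `T_r c = (r+1) c` for primes `r ≡ 1 (mod t^M)`, while `c` is generalised
`λ(r)`-eigen (`isHeckeGenEigenvector_degeneracyPullbackZ`); hNT supplies such an `r ∉ S` with `λ(r) ≠ r + 1`, forcing
`c = 0`.  No parabolicity is used. [folklore] -/
theorem oddShiftReduction (p t n : ℕ) :
    p.Prime → t.Prime → Odd n →
    ∀ (K : Type) [Field K] [CharP K p] (L : ℕ) [NeZero L] [NeZero t] (S : Finset ℕ)
      (lam : ℕ → K) (u : cocycles 0 L K),
      (∀ q : ℕ, q.Prime → q ∣ p * t * L → q ∈ S) →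
      IsHeckeGenEigenvector S lam u →
      (∀ M : ℕ, ∃ r : ℕ, r.Prime ∧ r ∉ S ∧ r ≡ 1 [MOD t ^ M] ∧ lam r ≠ (r : K) + 1) →
      degeneracyPullback 0 L (L * t ^ n) (t ^ n) K dvd_rfl (u : Gamma0 L → Fin 1 → K) =
        degeneracyPullback 0 L (L * t ^ n) 1 K (by simp) (u : Gamma0 L → Fin 1 → K) →
      degeneracyPullback 0 L (L * t) t K dvd_rfl (u : Gamma0 L → Fin 1 → K) =
        degeneracyPullback 0 L (L * t) 1 K (by simp) (u : Gamma0 L → Fin 1 → K) := by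
  intro _ ht hn K _ _ L _ _ S lam u hS hgen hNT hshift
  classical
  obtain ⟨m, rfl⟩ := hn
  have ht0 : t ≠ 0 := ht.ne_zero
  -- `L = t^k L'` with `t ∤ L'`
  set k : ℕ := L.factorization t with hk
  set L' : ℕ := L / t ^ k with hL'def
  have hL : L = t ^ k * L' := (Nat.ordProj_mul_ordCompl_eq_self L t).symm
  have hL' : ¬ t ∣ L' := Nat.not_dvd_ordCompl ht (NeZero.ne L)
  -- entry form of the `tⁿ`-shift invariance
  have hsh := apply_eq_of_shiftInvariant hshift
  -- `diag(t,t⁻¹)^m` is GOOD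
  obtain ⟨e, hgood⟩ := exists_good_of_mem_Delta t (2 * m + 1) k L' (u : Gamma0 L → Fin 1 → K) ht (by omega) hL hL' u.2
    hsh (Subgroup.pow_mem _ (diagP_mem_Delta t L') m)
  -- the difference cocycle at level `Lt`
  haveI : NeZero (L * t) := ⟨Nat.mul_ne_zero (NeZero.ne L) ht0⟩
  set c : cocycles 0 (L * t) K :=
    degeneracyPullbackZ 0 L (L * t) t K dvd_rfl u - degeneracyPullbackZ 0 L (L * t) 1 K (by simp) u with hc
  have hcoe : (c : Gamma0 (L * t) → Fin 1 → K) =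
      degeneracyPullback 0 L (L * t) t K dvd_rfl (u : Gamma0 L → Fin 1 → K) -
        degeneracyPullback 0 L (L * t) 1 K (by simp) (u : Gamma0 L → Fin 1 → K) := by
    rw [hc, Submodule.coe_sub, coe_degeneracyPullbackZ, coe_degeneracyPullbackZ]
  -- it kills the deep `t`-congruence subgroup
  set M₀ : ℕ := e + 2 * m with hM₀
  haveI : NeZero (t ^ M₀) := ⟨pow_ne_zero _ ht0⟩
  have hkill : ∀ γ : Gamma0 (L * t),
      (∀ i j, ((gmat γ i j : ℤ) : ZMod (t ^ M₀)) = (((1 : Matrix (Fin 2) (Fin 2) ℤ) i j : ℤ) : ZMod (t ^ M₀))) →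
        (c : Gamma0 (L * t) → Fin 1 → K) γ = 0 := by
    intro γ hγ
    have hmem : (γ : SL(2, ℤ)) ∈ Gamma (t ^ M₀) := by
      rw [Gamma_mem]
      refine ⟨?_, ?_, ?_, ?_⟩
      · have h := hγ 0 0; simpa using h
      · have h := hγ 0 1; simpa using h
      · have h := hγ 1 0; simpa using h
      · have h := hγ 1 1; simpa using h
    rw [hcoe, Pi.sub_apply, degeneracyPullback_zero_apply, degeneracyPullback_zero_apply, sub_eq_zero]
    exact shiftDifference_apply_eq_zero_of_deep ht hsh hgood γ hmem
  -- a prime `r ≡ 1 (mod t^{M₀})` outside `S` with `λ(r) ≠ r + 1`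
  obtain ⟨r, hr, hrS, hrM, hlam⟩ := hNT M₀
  haveI : NeZero r := ⟨hr.ne_zero⟩
  have hrLt : ¬ r ∣ L * t := fun h ↦ hrS (hS r hr (by rw [mul_assoc, mul_comm t L]; exact h.mul_left _))
  -- LEMMA C: `T_r c = (r+1) c`
  have hC := heckeU_eq_smul_of_kills_congruence hr c.2 hkill hrLt hrM
  have hT : heckeUZ 0 (L * t) K hr c = ((r : K) + 1) • c := by
    apply Subtype.ext
    rw [coe_heckeUZ, Submodule.coe_smul, hC]
  -- `c` is generalised `λ(r)`-eigen
  have hSLt : ∀ q : ℕ, q.Prime → q ∣ L * t → q ∈ S := fun q hq hqd ↦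
    hS q hq (by rw [mul_assoc, mul_comm t L]; exact hqd.mul_left _)
  have hgen_c : c ∈ Module.End.maxGenEigenspace (heckeUZ 0 (L * t) K hr) (lam r) := by
    have h1 := isHeckeGenEigenvector_degeneracyPullbackZ (d := t) (dvd_rfl : L * t ∣ L * t) hSLt hgen r hr hrS
    have h2 := isHeckeGenEigenvector_degeneracyPullbackZ (d := 1) (by simp : L * 1 ∣ L * t) hSLt hgen r hr hrS
    rw [hc]
    exact Submodule.sub_mem _ h1 h2
  -- conclude `c = 0`
  have hc0 : c = 0 := by
    by_contra hne
    exact hlam (eq_of_apply_eq_smul_of_mem_maxGenEigenspace _ hT hgen_c hne)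
  rw [← sub_eq_zero, ← hcoe, hc0, Submodule.coe_zero]

end OddShift

end Summit.BirchSwinnertonDyer.BirchSwinnertonDyer.Theorems.ManinLocalTwoThree
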